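import Literature.NumberTheory.Sieve.LinearPairMoebiusMainTerm

/-!
# Balanced pair window, generic weights — I: the inner sum (soloist file, project (F)-kernel, L2a)

Soloist file (informed mode).  The Literature file `LinearPairMoebiusMainTerm` treats the main term of
the balanced divisor window for a pair of linear congruences with the weight
`μ(d₀) log d₀ · μ(d₁) log d₁`.  The twin-prime kernel needs the divisor weight
`μ(e₁) μ(e₂) log²(e₁e₂) = μ log² ⊗ μ + 2 μ log ⊗ μ log + μ ⊗ μ log²`, so we redo the inner sum for an
inner weight `μ(d₁) h(d₁)` with `h(n) = α + β log n + γ log² n`: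
* `inner_eq_gen` — grouping by `e = gcd(d₀, d₁)` for an arbitrary `h : ℕ → ℝ`
  (verbatim the Literature proof of `LinearPairMoebius.inner_eq`);
* `abs_inner_le_quad` — the inner sum over `(⌊A⌋, b]` is
  `≤ τ(D) (1 + log D)² (C₀ + C₁ + C₂) Λ (2 + log b) 4^{ω(q₁)} 4^{ω(d₀)} (log(A/D))^{-8}` from three
  Siegel–Walfisz-strength tails (`Σ μ(m)/m`, `Σ μ(m) log m/m`, `Σ μ(m) log² m/m` over `(m, d₀q₁) = 1`,
  taken as hypotheses; the third carries the factor `2 + log W`).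
[folklore]
-/

namespace Summit.Parity.BatemanHorn.Theorems.PairWindow

open Finset Real
open scoped ArithmeticFunction.Moebius ArithmeticFunction.omega
open Literature.NumberTheory.Sieve

/-! ### Grouping by `e = gcd(d₀, d₁)` for a general inner weight -/

/-- `μ(e m) h(em) · e/(em) = [gcd(e,m)=1] μ(e) μ(m) h(em)/m` for `e, m ≥ 1`. [folklore] -/
theorem moebius_mul_term_gen (h : ℕ → ℝ) {e m : ℕ} (he : 0 < e) (hm : 0 < m) :
    (μ (e * m) : ℝ) * h (e * m) * ((e : ℝ) / ((e * m : ℕ) : ℝ)) =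
      if Nat.Coprime e m then (μ e : ℝ) * (μ m : ℝ) * h (e * m) / m else 0 := by
  have he0 : (e : ℝ) ≠ 0 := by exact_mod_cast he.ne'
  have hm0 : (m : ℝ) ≠ 0 := by exact_mod_cast hm.ne'
  split_ifs with hcop
  · rw [ArithmeticFunction.isMultiplicative_moebius.map_mul_of_coprime hcop]
    push_cast
    field_simp
  · have hsq : ¬ Squarefree (e * m) := by
      intro hsf
      exact hcop ((Nat.squarefree_mul_iff.1 hsf).1)
    rw [ArithmeticFunction.moebius_eq_zero_of_not_squarefree hsq]
    simp

/-- **The inner sum, grouped by `e = gcd(d₀, d₁)`, general weight.**  For `d₀, q₁`, an integer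
`Δ ≠ 0`, naturals `a, b` and any `h : ℕ → ℝ`:
`Σ_{a < d₁ ≤ b} [gcd(d₁,q₁)=1] [gcd(d₀,d₁) ∣ Δ] μ(d₁) h(d₁) gcd(d₀,d₁)/d₁
   = Σ_{e ∣ gcd(d₀, |Δ|)} [gcd(e,q₁)=1] μ(e) Σ_{a/e < m ≤ b/e, gcd(m, d₀q₁)=1} μ(m) h(em)/m`.
[folklore] -/
theorem inner_eq_gen (h : ℕ → ℝ) (d₀ q₁ : ℕ) {Δ : ℤ} (hΔ : Δ ≠ 0) (a b : ℕ) :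
    ∑ d₁ ∈ Finset.Ioc a b,
        (if Nat.Coprime d₁ q₁ ∧ ((Nat.gcd d₀ d₁ : ℕ) : ℤ) ∣ Δ then
          (μ d₁ : ℝ) * h d₁ * ((Nat.gcd d₀ d₁ : ℝ) / d₁) else 0) =
      ∑ e ∈ (Nat.gcd d₀ Δ.natAbs).divisors,
        if Nat.Coprime e q₁ then
          (μ e : ℝ) * ∑ m ∈ (Finset.Ioc (a / e) (b / e)).filter (fun m : ℕ => m.Coprime (d₀ * q₁)),
            (μ m : ℝ) * h (e * m) / m
        else 0 := by
  classical
  have hD : 0 < Δ.natAbs := Int.natAbs_pos.2 hΔ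
  -- insert `1 = Σ_{e ∣ gcd(d₀,|Δ|)} [gcd(d₀,d₁) = e]` on the support
  have hLHS : ∀ d₁ ∈ Finset.Ioc a b,
      (if Nat.Coprime d₁ q₁ ∧ ((Nat.gcd d₀ d₁ : ℕ) : ℤ) ∣ Δ then
          (μ d₁ : ℝ) * h d₁ * ((Nat.gcd d₀ d₁ : ℝ) / d₁) else 0) =
        ∑ e ∈ (Nat.gcd d₀ Δ.natAbs).divisors,
          if Nat.gcd d₀ d₁ = e ∧ Nat.Coprime d₁ q₁ then
            (μ d₁ : ℝ) * h d₁ * ((e : ℝ) / d₁) else 0 := by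
    intro d₁ _
    by_cases hc : Nat.Coprime d₁ q₁ ∧ ((Nat.gcd d₀ d₁ : ℕ) : ℤ) ∣ Δ
    · rw [if_pos hc]
      have hmem : Nat.gcd d₀ d₁ ∈ (Nat.gcd d₀ Δ.natAbs).divisors := by
        rw [Nat.mem_divisors]
        refine ⟨Nat.dvd_gcd (Nat.gcd_dvd_left _ _) ?_, (Nat.gcd_pos_of_pos_right _ hD).ne'⟩
        exact Int.natCast_dvd.1 hc.2
      rw [Finset.sum_eq_single_of_mem _ hmem]
      · rw [if_pos ⟨rfl, hc.1⟩]
      · intro e _ hne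
        rw [if_neg]
        rintro ⟨h1, -⟩
        exact hne h1.symm
    · rw [if_neg hc]
      symm
      refine Finset.sum_eq_zero fun e he => ?_
      rw [if_neg]
      rintro ⟨h1, h2⟩
      apply hc
      refine ⟨h2, ?_⟩
      rw [h1]
      have := Nat.dvd_trans (Nat.dvd_of_mem_divisors he) (Nat.gcd_dvd_right _ _)
      exact Int.natCast_dvd.2 this
  rw [Finset.sum_congr rfl hLHS, Finset.sum_comm]
  refine Finset.sum_congr rfl fun e he => ?_
  have he0 : 0 < e := Nat.pos_of_mem_divisors he
  have hed₀ : e ∣ d₀ := Nat.dvd_trans (Nat.dvd_of_mem_divisors he) (Nat.gcd_dvd_left _ _)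
  -- restrict to `e ∣ d₁`
  have hsupp : ∑ d₁ ∈ Finset.Ioc a b,
      (if Nat.gcd d₀ d₁ = e ∧ Nat.Coprime d₁ q₁ then
        (μ d₁ : ℝ) * h d₁ * ((e : ℝ) / d₁) else 0) =
      ∑ d₁ ∈ (Finset.Ioc a b).filter (fun d₁ : ℕ => e ∣ d₁),
        (if Nat.gcd d₀ d₁ = e ∧ Nat.Coprime d₁ q₁ then
          (μ d₁ : ℝ) * h d₁ * ((e : ℝ) / d₁) else 0) := by
    rw [Finset.sum_filter]
    refine Finset.sum_congr rfl fun d₁ _ => ?_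
    by_cases hdiv : e ∣ d₁
    · rw [if_pos hdiv]
    · rw [if_neg hdiv, if_neg]
      rintro ⟨h1, -⟩
      exact hdiv (h1 ▸ Nat.gcd_dvd_right d₀ d₁)
  -- reindex `d₁ = e m`
  have himage : (Finset.Ioc a b).filter (fun d₁ : ℕ => e ∣ d₁) =
      (Finset.Ioc (a / e) (b / e)).image (fun m => e * m) := by
    ext d₁
    rw [Finset.mem_filter, Finset.mem_image]
    constructor
    · rintro ⟨hd₁, m, rfl⟩
      exact ⟨m, (LinearPairMoebius.mul_mem_Ioc_iff he0).1 hd₁, rfl⟩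
    · rintro ⟨m, hm, rfl⟩
      exact ⟨(LinearPairMoebius.mul_mem_Ioc_iff he0).2 hm, Dvd.intro m rfl⟩
  have hinj : Set.InjOn (fun m => e * m) ↑(Finset.Ioc (a / e) (b / e)) :=
    fun m _ m' _ hmm => Nat.eq_of_mul_eq_mul_left he0 hmm
  rw [hsupp, himage, Finset.sum_image hinj]
  -- evaluate the summand at `d₁ = e m`
  have hterm : ∀ m ∈ Finset.Ioc (a / e) (b / e),
      (if Nat.gcd d₀ (e * m) = e ∧ Nat.Coprime (e * m) q₁ then
        (μ (e * m) : ℝ) * h (e * m) * ((e : ℝ) / ((e * m : ℕ) : ℝ)) else 0) =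
      if Nat.Coprime e q₁ ∧ m.Coprime (d₀ * q₁) then
        (μ e : ℝ) * ((μ m : ℝ) * h (e * m) / m) else 0 := by
    intro m hm
    have hm0 : 0 < m := lt_of_le_of_lt (Nat.zero_le _) (Finset.mem_Ioc.1 hm).1
    rw [moebius_mul_term_gen h he0 hm0]
    have hiff : (Nat.gcd d₀ (e * m) = e ∧ Nat.Coprime (e * m) q₁) ↔
        (Nat.Coprime (d₀ / e) m ∧ Nat.Coprime e q₁ ∧ Nat.Coprime m q₁) := by
      rw [LinearPairMoebius.gcd_mul_eq_iff he0 hed₀, Nat.coprime_mul_iff_left]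
    by_cases hA : Nat.Coprime (d₀ / e) m ∧ Nat.Coprime e q₁ ∧ Nat.Coprime m q₁
    · rw [if_pos (hiff.2 hA)]
      by_cases hB : Nat.Coprime e m
      · rw [if_pos hB, if_pos]
        · ring
        · refine ⟨hA.2.1, Nat.coprime_mul_iff_right.2 ⟨?_, hA.2.2⟩⟩
          exact Nat.Coprime.symm ((LinearPairMoebius.coprime_div_and_iff he0 hed₀).1 ⟨hA.1, hB⟩)
      · rw [if_neg hB, if_neg]
        rintro ⟨-, h2⟩
        have hd₀m : Nat.Coprime d₀ m := (Nat.coprime_mul_iff_right.1 h2).1.symm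
        exact hB ((LinearPairMoebius.coprime_div_and_iff he0 hed₀).2 hd₀m).2
    · rw [if_neg (fun h' => hA (hiff.1 h'))]
      split_ifs with hB
      · exfalso
        apply hA
        have hd₀m : Nat.Coprime d₀ m := (Nat.coprime_mul_iff_right.1 hB.2).1.symm
        exact ⟨((LinearPairMoebius.coprime_div_and_iff he0 hed₀).2 hd₀m).1, hB.1,
          (Nat.coprime_mul_iff_right.1 hB.2).2⟩
      · rfl
  rw [Finset.sum_congr rfl hterm]
  by_cases hcop : Nat.Coprime e q₁
  · rw [if_pos hcop, Finset.mul_sum, Finset.sum_filter]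
    refine Finset.sum_congr rfl fun m _ => ?_
    by_cases hm : m.Coprime (d₀ * q₁)
    · rw [if_pos ⟨hcop, hm⟩, if_pos hm]
    · rw [if_neg (fun h' => hm h'.2), if_neg hm]
  · rw [if_neg hcop]
    refine Finset.sum_eq_zero fun m _ => ?_
    rw [if_neg (fun h' => hcop h'.1)]

/-! ### The inner sum is small: quadratic-in-log weights -/

/-- Coefficient bookkeeping for `h(em) = α + β(l + log m) + γ(l + log m)²`, `l = log e ∈ [0, L]`,
`|α|, |β|, |γ| ≤ Λ`: the three coefficients of `1, log m, log² m` are `≤ Λ (1 + L)²` in absolute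
value. [folklore] -/
theorem abs_quad_coeff_le {α β γ Λ l L : ℝ} (hα : |α| ≤ Λ) (hβ : |β| ≤ Λ) (hγ : |γ| ≤ Λ)
    (hl0 : 0 ≤ l) (hlL : l ≤ L) :
    |α + β * l + γ * l ^ 2| ≤ Λ * (1 + L) ^ 2 ∧ |β + 2 * γ * l| ≤ Λ * (1 + L) ^ 2 ∧
      |γ| ≤ Λ * (1 + L) ^ 2 := by
  have hΛ0 : 0 ≤ Λ := (abs_nonneg α).trans hα
  have hL0 : 0 ≤ L := hl0.trans hlL
  have hΛL : 0 ≤ Λ * L := mul_nonneg hΛ0 hL0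
  have hΛL2 : 0 ≤ Λ * L ^ 2 := mul_nonneg hΛ0 (sq_nonneg L)
  have hsq : Λ * (1 + L) ^ 2 = Λ + 2 * (Λ * L) + Λ * L ^ 2 := by ring
  refine ⟨?_, ?_, ?_⟩
  · calc |α + β * l + γ * l ^ 2|
        ≤ |α| + |β * l| + |γ * l ^ 2| := abs_add_three _ _ _
      _ = |α| + |β| * l + |γ| * l ^ 2 := by
          rw [abs_mul, abs_mul, abs_of_nonneg hl0, abs_of_nonneg (pow_nonneg hl0 2)]
      _ ≤ Λ + Λ * L + Λ * L ^ 2 := by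
          refine add_le_add (add_le_add hα ?_) ?_
          · exact mul_le_mul hβ hlL hl0 hΛ0
          · exact mul_le_mul hγ (pow_le_pow_left₀ hl0 hlL 2) (by positivity) hΛ0
      _ ≤ Λ * (1 + L) ^ 2 := by rw [hsq]; linarith
  · calc |β + 2 * γ * l| ≤ |β| + |2 * γ * l| := abs_add_le _ _
      _ = |β| + 2 * |γ| * l := by
          rw [abs_mul, abs_mul, abs_of_nonneg hl0, abs_two]
      _ ≤ Λ + 2 * (Λ * L) := by
          refine add_le_add hβ ?_
          have : |γ| * l ≤ Λ * L := mul_le_mul hγ hlL hl0 hΛ0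
          linarith
      _ ≤ Λ * (1 + L) ^ 2 := by rw [hsq]; linarith
  · calc |γ| ≤ Λ := hγ
      _ = Λ * 1 := by ring
      _ ≤ Λ * (1 + L) ^ 2 := by
          refine mul_le_mul_of_nonneg_left ?_ hΛ0
          nlinarith

/-- **The inner sum is small (weight `μ(d₁)(α + β log d₁ + γ log² d₁)`).**  Let `q₁ ≥ 1`, `Δ ≠ 0`,
`D = |Δ|`, let `C₀, C₁, C₂` be constants of the three Siegel–Walfisz-strength tails
`Σ_{A<m≤W,(m,q)=1} μ(m)/m`, `… μ(m) log m/m` (both `≤ Cᵢ 4^{ω(q)} (log A)^{-8}`) and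
`… μ(m) log² m/m ≤ C₂ 4^{ω(q)} (2 + log W) (log A)^{-8}`, and `|α|, |β|, |γ| ≤ Λ`.  Then for
`d₀ ≥ 1`, real `A ≥ 2D` and natural `b`,
`|Σ_{⌊A⌋ < d₁ ≤ b} [gcd(d₁,q₁)=1][gcd(d₀,d₁) ∣ Δ] μ(d₁)(α + β log d₁ + γ log² d₁) gcd(d₀,d₁)/d₁|
   ≤ τ(D) (1 + log D)² (C₀ + C₁ + C₂) Λ (2 + log b) 4^{ω(q₁)} 4^{ω(d₀)} (log(A/D))^{-8}`. [folklore] -/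
theorem abs_inner_le_quad {q₁ : ℕ} (hq₁ : 0 < q₁) {Δ : ℤ} (hΔ : Δ ≠ 0) {C₀ C₁ C₂ : ℝ}
    (hC₀0 : 0 ≤ C₀) (hC₁0 : 0 ≤ C₁) (hC₂0 : 0 ≤ C₂)
    (hC₀ : ∀ q : ℕ, q ≠ 0 → ∀ A W : ℝ, 2 ≤ A → A ≤ W →
      |∑ n ∈ (Ioc ⌊A⌋₊ ⌊W⌋₊).filter (fun n : ℕ => n.Coprime q), (μ n : ℝ) / n| ≤
        C₀ * (4 : ℝ) ^ q.primeFactors.card / Real.log A ^ (8 : ℝ))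
    (hC₁ : ∀ q : ℕ, q ≠ 0 → ∀ A W : ℝ, 2 ≤ A → A ≤ W →
      |∑ n ∈ (Ioc ⌊A⌋₊ ⌊W⌋₊).filter (fun n : ℕ => n.Coprime q), (μ n : ℝ) * Real.log n / n| ≤
        C₁ * (4 : ℝ) ^ q.primeFactors.card / Real.log A ^ (8 : ℝ))
    (hC₂ : ∀ q : ℕ, q ≠ 0 → ∀ A W : ℝ, 2 ≤ A → A ≤ W →
      |∑ n ∈ (Ioc ⌊A⌋₊ ⌊W⌋₊).filter (fun n : ℕ => n.Coprime q),
          (μ n : ℝ) * Real.log n ^ 2 / n| ≤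
        C₂ * (4 : ℝ) ^ q.primeFactors.card * (2 + Real.log W) / Real.log A ^ (8 : ℝ))
    {α β γ Λ : ℝ} (hα : |α| ≤ Λ) (hβ : |β| ≤ Λ) (hγ : |γ| ≤ Λ)
    {d₀ : ℕ} (hd₀ : 0 < d₀) {A : ℝ} (hA : 2 * (Δ.natAbs : ℝ) ≤ A) {b : ℕ} (hb : 1 ≤ b) :
    |∑ d₁ ∈ Finset.Ioc ⌊A⌋₊ b,
        (if Nat.Coprime d₁ q₁ ∧ ((Nat.gcd d₀ d₁ : ℕ) : ℤ) ∣ Δ then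
          (μ d₁ : ℝ) * (α + β * Real.log d₁ + γ * Real.log d₁ ^ 2) *
            ((Nat.gcd d₀ d₁ : ℝ) / d₁) else 0)| ≤
      (Δ.natAbs.divisors.card : ℝ) * (1 + Real.log Δ.natAbs) ^ 2 * (C₀ + C₁ + C₂) * Λ *
        (2 + Real.log b) * (4 : ℝ) ^ q₁.primeFactors.card * (4 : ℝ) ^ d₀.primeFactors.card /
          Real.log (A / Δ.natAbs) ^ (8 : ℝ) := by
  set D : ℕ := Δ.natAbs with hDdef
  have hD : 0 < D := Int.natAbs_pos.2 hΔ
  have hD1 : (1 : ℝ) ≤ D := by exact_mod_cast hD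
  have hDpos : (0 : ℝ) < D := by positivity
  have hA2 : (2 : ℝ) ≤ A / D := by rw [le_div_iff₀ hDpos]; linarith
  have hlogAD : 0 < Real.log (A / D) := Real.log_pos (by linarith)
  have hlogD : 0 ≤ Real.log D := Real.log_nonneg hD1
  have hA0 : 0 ≤ A := by nlinarith
  have hΛ0 : 0 ≤ Λ := (abs_nonneg α).trans hα
  have hb1 : (1 : ℝ) ≤ b := by exact_mod_cast hb
  have hbpos : (0 : ℝ) < b := by linarith
  have hlogb : 0 ≤ Real.log b := Real.log_nonneg hb1
  -- the grouped form
  rw [show b = ⌊((b : ℕ) : ℝ)⌋₊ by rw [Nat.floor_natCast],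
    inner_eq_gen (fun n : ℕ => α + β * Real.log n + γ * Real.log n ^ 2) d₀ q₁ hΔ]
  rw [Nat.floor_natCast]
  -- each `e`-term
  set RHS1 : ℝ := (1 + Real.log D) ^ 2 * (C₀ + C₁ + C₂) * Λ * (2 + Real.log b) *
    (4 : ℝ) ^ q₁.primeFactors.card * (4 : ℝ) ^ d₀.primeFactors.card /
      Real.log (A / D) ^ (8 : ℝ) with hRHS1
  have hRHS1_nonneg : 0 ≤ RHS1 := by rw [hRHS1]; positivity
  have hterm : ∀ e ∈ (Nat.gcd d₀ D).divisors,
      |(if Nat.Coprime e q₁ then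
          (μ e : ℝ) * ∑ m ∈ (Finset.Ioc (⌊A⌋₊ / e) (b / e)).filter
              (fun m : ℕ => m.Coprime (d₀ * q₁)),
            (μ m : ℝ) * (fun n : ℕ => α + β * Real.log n + γ * Real.log n ^ 2) (e * m) / m
        else 0)| ≤ RHS1 := by
    intro e he
    have he0 : 0 < e := Nat.pos_of_mem_divisors he
    have heD : e ∣ D := Nat.dvd_trans (Nat.dvd_of_mem_divisors he) (Nat.gcd_dvd_right _ _)
    have heDle : (e : ℝ) ≤ D := by exact_mod_cast Nat.le_of_dvd hD heD
    have he1 : (1 : ℝ) ≤ e := by exact_mod_cast he0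
    have hepos : (0 : ℝ) < e := by positivity
    have heR0 : (e : ℝ) ≠ 0 := hepos.ne'
    split_ifs with hcop
    swap
    · rw [abs_zero]; exact hRHS1_nonneg
    -- the ranges as floors of reals
    have hfloorA : ⌊A⌋₊ / e = ⌊A / e⌋₊ := (Nat.floor_div_natCast A e).symm
    have hfloorb : b / e = ⌊(b : ℝ) / e⌋₊ := by
      rw [Nat.floor_div_natCast, Nat.floor_natCast]
    rw [hfloorA, hfloorb]
    have hAe2 : 2 ≤ A / e := by
      rw [le_div_iff₀ hepos]
      calc 2 * (e : ℝ) ≤ 2 * D := by linarith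
        _ ≤ A := hA
    have hlogAe : Real.log (A / D) ≤ Real.log (A / e) := by
      refine Real.log_le_log (by linarith) ?_
      exact div_le_div_of_nonneg_left hA0 hepos heDle
    have hq : d₀ * q₁ ≠ 0 := Nat.mul_ne_zero hd₀.ne' hq₁.ne'
    -- `log(b/e) ≤ log b`
    have hlogbe : Real.log ((b : ℝ) / e) ≤ Real.log b := by
      refine Real.log_le_log (div_pos hbpos hepos) ?_
      exact div_le_self hbpos.le he1
    -- split `h(em)` into the three tails
    set S := (Finset.Ioc ⌊A / e⌋₊ ⌊(b : ℝ) / e⌋₊).filter (fun m : ℕ => m.Coprime (d₀ * q₁))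
      with hSdef
    set T₀ := ∑ m ∈ S, (μ m : ℝ) / m with hT₀
    set T₁ := ∑ m ∈ S, (μ m : ℝ) * Real.log m / m with hT₁
    set T₂ := ∑ m ∈ S, (μ m : ℝ) * Real.log m ^ 2 / m with hT₂
    have hsplit : ∑ m ∈ S,
        (μ m : ℝ) * (fun n : ℕ => α + β * Real.log n + γ * Real.log n ^ 2) (e * m) / m =
        (α + β * Real.log e + γ * Real.log e ^ 2) * T₀ + (β + 2 * γ * Real.log e) * T₁ +
          γ * T₂ := by
      rw [hT₀, hT₁, hT₂, Finset.mul_sum, Finset.mul_sum, Finset.mul_sum, ← Finset.sum_add_distrib,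
        ← Finset.sum_add_distrib]
      refine Finset.sum_congr rfl fun m hm => ?_
      have hm0 : 0 < m := by
        have := (Finset.mem_Ioc.1 (Finset.mem_filter.1 hm).1).1
        omega
      have hmR : (m : ℝ) ≠ 0 := by exact_mod_cast hm0.ne'
      have hlog : Real.log ((e * m : ℕ) : ℝ) = Real.log e + Real.log m := by
        push_cast
        exact Real.log_mul heR0 hmR
      simp only [hlog]
      ring
    rw [hsplit]
    have hμe : |(μ e : ℝ)| ≤ 1 := by exact_mod_cast ArithmeticFunction.abs_moebius_le_one
    -- bounds on the three tails (empty range if `b/e < A/e`)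
    have h4 := BFI.four_pow_card_primeFactors_mul_le d₀ q₁
    have hpow8 : Real.log (A / D) ^ (8 : ℝ) ≤ Real.log (A / e) ^ (8 : ℝ) :=
      Real.rpow_le_rpow hlogAD.le hlogAe (by norm_num)
    have hpow8pos : 0 < Real.log (A / D) ^ (8 : ℝ) := Real.rpow_pos_of_pos hlogAD _
    set Φ : ℝ := (4 : ℝ) ^ d₀.primeFactors.card * (4 : ℝ) ^ q₁.primeFactors.card /
      Real.log (A / D) ^ (8 : ℝ) with hΦ
    have hΦ0 : 0 ≤ Φ := by positivity
    have hS₀ : |T₀| ≤ C₀ * Φ := by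
      rw [hΦ, ← mul_div_assoc, hT₀, hSdef]
      rcases le_or_gt (A / e) ((b : ℝ) / e) with hle | hgt
      · refine (hC₀ _ hq _ _ hAe2 hle).trans ?_
        gcongr
      · have hempty : Finset.Ioc ⌊A / e⌋₊ ⌊(b : ℝ) / e⌋₊ = ∅ :=
          Finset.Ioc_eq_empty (not_lt.2 (Nat.floor_le_floor hgt.le))
        rw [hempty, Finset.filter_empty, Finset.sum_empty, abs_zero]
        positivity
    have hS₁ : |T₁| ≤ C₁ * Φ := by
      rw [hΦ, ← mul_div_assoc, hT₁, hSdef]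
      rcases le_or_gt (A / e) ((b : ℝ) / e) with hle | hgt
      · refine (hC₁ _ hq _ _ hAe2 hle).trans ?_
        gcongr
      · have hempty : Finset.Ioc ⌊A / e⌋₊ ⌊(b : ℝ) / e⌋₊ = ∅ :=
          Finset.Ioc_eq_empty (not_lt.2 (Nat.floor_le_floor hgt.le))
        rw [hempty, Finset.filter_empty, Finset.sum_empty, abs_zero]
        positivity
    have hS₂ : |T₂| ≤ C₂ * (2 + Real.log b) * Φ := by
      rw [hΦ, ← mul_div_assoc, hT₂, hSdef]
      rcases le_or_gt (A / e) ((b : ℝ) / e) with hle | hgt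
      · refine (hC₂ _ hq _ _ hAe2 hle).trans ?_
        have h2 : 2 + Real.log ((b : ℝ) / e) ≤ 2 + Real.log b := by linarith
        have h20 : 0 ≤ 2 + Real.log ((b : ℝ) / e) := by
          have : 0 ≤ Real.log ((b : ℝ) / e) := Real.log_nonneg (by linarith)
          linarith
        rw [div_le_div_iff₀ (lt_of_lt_of_le hpow8pos hpow8) hpow8pos]
        calc C₂ * (4 : ℝ) ^ (d₀ * q₁).primeFactors.card * (2 + Real.log ((b : ℝ) / e)) *
              Real.log (A / D) ^ (8 : ℝ)
            ≤ C₂ * ((4 : ℝ) ^ d₀.primeFactors.card * (4 : ℝ) ^ q₁.primeFactors.card) *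
              (2 + Real.log b) * Real.log (A / e) ^ (8 : ℝ) := by
              gcongr
        _ = _ := by ring
      · have hempty : Finset.Ioc ⌊A / e⌋₊ ⌊(b : ℝ) / e⌋₊ = ∅ :=
          Finset.Ioc_eq_empty (not_lt.2 (Nat.floor_le_floor hgt.le))
        rw [hempty, Finset.filter_empty, Finset.sum_empty, abs_zero]
        positivity
    have hloge : Real.log e ≤ Real.log D := Real.log_le_log hepos heDle
    have hloge0 : 0 ≤ Real.log e := Real.log_nonneg he1
    -- the three coefficients are `≤ Λ (1 + log D)²`
    obtain ⟨hc₀, hc₁, hc₂⟩ := abs_quad_coeff_le hα hβ hγ hloge0 hloge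
    have h2b : (1 : ℝ) ≤ 2 + Real.log b := by linarith
    have hS₀' : |T₀| ≤ C₀ * (2 + Real.log b) * Φ := hS₀.trans (by
      calc C₀ * Φ = C₀ * 1 * Φ := by ring
        _ ≤ C₀ * (2 + Real.log b) * Φ := by gcongr)
    have hS₁' : |T₁| ≤ C₁ * (2 + Real.log b) * Φ := hS₁.trans (by
      calc C₁ * Φ = C₁ * 1 * Φ := by ring
        _ ≤ C₁ * (2 + Real.log b) * Φ := by gcongr)
    calc |(μ e : ℝ) * ((α + β * Real.log e + γ * Real.log e ^ 2) * T₀ +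
          (β + 2 * γ * Real.log e) * T₁ + γ * T₂)|
        = |(μ e : ℝ)| * |(α + β * Real.log e + γ * Real.log e ^ 2) * T₀ +
            (β + 2 * γ * Real.log e) * T₁ + γ * T₂| := abs_mul _ _
      _ ≤ 1 * (Λ * (1 + Real.log D) ^ 2 * (C₀ * (2 + Real.log b) * Φ) +
            Λ * (1 + Real.log D) ^ 2 * (C₁ * (2 + Real.log b) * Φ) +
            Λ * (1 + Real.log D) ^ 2 * (C₂ * (2 + Real.log b) * Φ)) := by
          refine mul_le_mul hμe ?_ (abs_nonneg _) zero_le_one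
          calc |(α + β * Real.log e + γ * Real.log e ^ 2) * T₀ +
                (β + 2 * γ * Real.log e) * T₁ + γ * T₂|
              ≤ |(α + β * Real.log e + γ * Real.log e ^ 2) * T₀| +
                  |(β + 2 * γ * Real.log e) * T₁| + |γ * T₂| := abs_add_three _ _ _
            _ = |α + β * Real.log e + γ * Real.log e ^ 2| * |T₀| +
                  |β + 2 * γ * Real.log e| * |T₁| + |γ| * |T₂| := by
                rw [abs_mul, abs_mul, abs_mul]
            _ ≤ _ := by
                refine add_le_add (add_le_add ?_ ?_) ?_
                · exact mul_le_mul hc₀ hS₀' (abs_nonneg _) (by positivity)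
                · exact mul_le_mul hc₁ hS₁' (abs_nonneg _) (by positivity)
                · exact mul_le_mul hc₂ hS₂ (abs_nonneg _) (by positivity)
      _ = RHS1 := by rw [hRHS1, hΦ]; ring
  -- sum over `e`
  calc |∑ e ∈ (Nat.gcd d₀ D).divisors, _| ≤ ∑ e ∈ (Nat.gcd d₀ D).divisors,
        |(if Nat.Coprime e q₁ then
          (μ e : ℝ) * ∑ m ∈ (Finset.Ioc (⌊A⌋₊ / e) (b / e)).filter
              (fun m : ℕ => m.Coprime (d₀ * q₁)),
            (μ m : ℝ) * (fun n : ℕ => α + β * Real.log n + γ * Real.log n ^ 2) (e * m) / m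
        else 0)| := Finset.abs_sum_le_sum_abs _ _
    _ ≤ ∑ _e ∈ (Nat.gcd d₀ D).divisors, RHS1 := Finset.sum_le_sum hterm
    _ = ((Nat.gcd d₀ D).divisors.card : ℝ) * RHS1 := by rw [Finset.sum_const, nsmul_eq_mul]
    _ ≤ (D.divisors.card : ℝ) * RHS1 := by
        refine mul_le_mul_of_nonneg_right ?_ hRHS1_nonneg
        exact_mod_cast Finset.card_le_card
          (Nat.divisors_subset_of_dvd hD.ne' (Nat.gcd_dvd_right _ _))
    _ = _ := by rw [hRHS1]; ring

end Summit.Parity.BatemanHorn.Theorems.PairWindow
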